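import Mathlib
import Literature.NumberTheory.EllipticCurves.Smith2016.CongruentNumberGenusDeterminantEvenBlocks
import Literature.NumberTheory.EllipticCurves.Smith2016.CongruentNumberGenusDeterminantRowThreeHolds

/-!
# Monsky's even matrix as a forest sum split along Smith's decomposition (towards Thm. 2.2 row 2, every `k`)

A. Smith, *The congruent numbers have positive natural density*, arXiv:1603.08479, §2.2
[Smith2016CongruentDensity] (chunk p0010 L1–L10): "`det M₂(A, y, z) = Σ_{S ⊆ [r]} det P(A, y, z)[S] ·
det M₁(A, z)[S′]`.  But our result above shows that, if `d | n` corresponds to `S` and `d ≡ 1 (4)`, then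
`det P(A, y, z)[S] = g(2d)`. This gives case 2."  For MONSKY's even matrix `M = [[Aᵀ + D₂, D₋₁],[D₂, A + D₂]]`
(Heath-Brown 1994, appendix, [HeathBrown1994SelmerCongruentII]) of `n = 2p₁⋯p_k` this file proves, for
every `k`:
* `det_monskyMatrixEven_eq_det_bigN` — swapping the block COLUMNS of `M` gives the (symmetric) doubled
  forest matrix of `A` with marks `t = ((−1/pᵢ)₊)`, roots and extra roots `z = ((2/pᵢ)₊)`:
  `det M = det [[D_t, (A + D_z)ᵀ],[A + D_z, D_z]]`;
* `det_monskyMatrixEven_eq_sum_powerset` — by the forest formula and `setExp_add` (the block weight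
  `t_C q_z + q_z` is the SUM of the row-1 weight `(1 + z_C) q_z` and the mark weight `(t_C + z_C) q_z`):
  `det M = Σ_{S} [Σ_{π ∈ Part(S)} ∏ (t_C + z_C) q_z(A^C)] · [Σ_{π ∈ Part(Sᶜ)} ∏ (1 + z_C) q_z(A^C)]` —
  Smith's decomposition, with `det P(A, y, z)[S]` and `det M₁[S′]` in forest form;
* `det_monskyMatrixEven_eq_sum_genusWeight` — for `∏ pᵢ ≡ 1 (mod 4)`: the second factor is the row-1
  decomposition sum of `d_{Sᶜ}`, zero unless `d_{Sᶜ} ≡ 1 (8)`; in that case `Σ_S t = 0` and the first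
  factor is `g(2 d_S)` (`CongruentNumberGenusDeterminantEvenBlocks`), so
  `det M = Σ_S g(2 d_S) · Σ_{D′ ∈ decompositions(d_{Sᶜ})} ∏ [d ≡ 1 (8)] g(d)`.
The identification with `ℒ₂(n) = genusSum₁ (2∏pᵢ) g` is `CongruentNumberGenusDeterminantRowTwoHolds`.
-/

namespace Literature.NumberTheory.EllipticCurves.Smith2016

open _root_.Matrix Finset Literature.LinearAlgebra.Matrix Literature.Combinatorics.Enumerative
open Literature.NumberTheory.EllipticCurves.HeathBrown1994
open Literature.NumberTheory.EllipticCurves.TianYuanZhang2017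
open Literature.NumberTheory.EllipticCurves.HeathBrown1994.Families (legendreMatrix_apply_of_ne legendreMatrix_apply_self)
open Literature.NumberTheory.EllipticCurves.MonskySelmerParity

section Forest

variable {V : Type*} [Fintype V] [DecidableEq V]

/-- The doubled matrix of a zero-row-sum matrix `A` on the whole vertex set, with marks `y` and
roots = extra roots = `z`, is `[[D_y, (A + D_z)ᵀ], [A + D_z, D_z]]`.
[cite: Smith2016CongruentDensity, §2.2 (the matrices M₂ and P(A, y, z))] -/
theorem bigN_univ_eq_fromBlocks_mark (A : Matrix V V (ZMod 2))
    (hA : ∀ i, A i i = ∑ j ∈ univ.erase i, A i j) (y z : V → ZMod 2) :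
    bigN (fun i j => A i j) univ y z z =
      fromBlocks (diagonal y) (A + diagonal z)ᵀ (A + diagonal z) (diagonal z) := by
  have hP : lapIn (fun i j => A i j) univ z = A + diagonal z := by
    ext i j
    rw [lapIn_apply, Matrix.add_apply, diagonal_apply]
    simp only [mem_univ, and_self, if_true]
    by_cases hij : i = j
    · subst hij; rw [if_pos rfl, if_pos rfl, hA i, add_comm]
    · rw [if_neg hij, if_neg hij, add_zero]
  unfold bigN
  rw [hP]
  congr 1 <;> (ext i j; simp [diagonal_apply])

end Forest

variable {k : ℕ} (p : Fin k → ℕ)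

section MatrixIdentity

/-- **Swapping the block columns of Monsky's even matrix gives the doubled forest matrix**:
`[[Aᵀ + D₂, D₋₁],[D₂, A + D₂]] · [[0, I],[I, 0]] = [[D₋₁, (A + D₂)ᵀ],[A + D₂, D₂]]` — a SYMMETRIC matrix,
the `bigN` of `A` with marks `t = ((−1/pᵢ)₊)`, roots `z = ((2/pᵢ)₊)`, extra roots `z`.
[cite: HeathBrown1994SelmerCongruentII, Appendix (Monsky), typescript p. 41 L20–L36 (the even matrix)] [cite: Smith2016CongruentDensity, §2.2 (P(A, y, z) and M₂)] -/
theorem monskyMatrixEven_mul_swap :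
    monskyMatrixEven p * fromBlocks (0 : Matrix (Fin k) (Fin k) (ZMod 2)) 1 1 0 =
      bigN (fun i j => legendreMatrix p i j) univ (fun i => addLegendreSym (-1) (p i))
        (fun i => addLegendreSym 2 (p i)) (fun i => addLegendreSym 2 (p i)) := by
  rw [monskyMatrixEven, fromBlocks_multiply, bigN_univ_eq_fromBlocks_mark _ (legendreMatrix_apply_self p)]
  simp only [Matrix.mul_zero, Matrix.mul_one, zero_add, add_zero]
  have hD2 : legendreDiagonal p 2 = diagonal fun i => addLegendreSym 2 (p i) := rfl
  have hD1 : legendreDiagonal p (-1) = diagonal fun i => addLegendreSym (-1) (p i) := rfl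
  rw [hD2, hD1, transpose_add, diagonal_transpose]

/-- **`det M = det N(A; t, z, z)`** for Monsky's even matrix (the swap has determinant `1` over `𝔽₂`).
[cite: HeathBrown1994SelmerCongruentII, Appendix (Monsky), typescript p. 41 L20–L36] -/
theorem det_monskyMatrixEven_eq_det_bigN :
    (monskyMatrixEven p).det =
      (bigN (fun i j => legendreMatrix p i j) univ (fun i => addLegendreSym (-1) (p i))
        (fun i => addLegendreSym 2 (p i)) (fun i => addLegendreSym 2 (p i))).det := by
  rw [← monskyMatrixEven_mul_swap p, det_mul, det_fromBlocks_swap, mul_one]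

end MatrixIdentity

section Split

/-- The block weight with marks `t`, roots and extra roots `z` splits as the row-1 weight plus the mark
weight: `t_C q_z(C) + q_z(C) = ((1 + z_C) q_z(C)) + ((t_C + z_C) q_z(C))` (characteristic `2`).
[cite: Smith2016CongruentDensity, §2.2 (chunk p0010 L1–L4: det M₂ = Σ_S det P[S] · det M₁[S′])] -/
theorem fwt_mark_eq_add (a : Fin k → Fin k → ZMod 2) (t z : Fin k → ZMod 2) :
    fwt a t z z = fwt a z z z + fun C => (∑ i ∈ C, (t i + z i)) * qwt a z C := by
  funext C
  have h2 : (2 : ZMod 2) = 0 := by decide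
  simp only [fwt, Pi.add_apply, sum_add_distrib]
  linear_combination (-(∑ i ∈ C, z i) * qwt a z C) * h2

/-- **Smith's decomposition of `det M₂`, in forest form**: `det M = Σ_{S ⊆ [k]} (Σ_{π ∈ Part(S)} ∏
(t_C + z_C) q_z(A^C)) · (Σ_{π ∈ Part(Sᶜ)} ∏ (z_C q_z(A^C) + q_z(A^C)))` — the first factor is
`det P(A, t, z)[S]`, the second `det M₁(A, z)[Sᶜ]`. [cite: Smith2016CongruentDensity, §2.2 (chunk p0010 L1–L4)] -/
theorem det_monskyMatrixEven_eq_sum_powerset :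
    (monskyMatrixEven p).det =
      ∑ S ∈ (univ : Finset (Fin k)).powerset,
        setExp (fun C => (∑ i ∈ C, (addLegendreSym (-1) (p i) + addLegendreSym 2 (p i))) *
            qwt (fun i j => legendreMatrix p i j) (fun i => addLegendreSym 2 (p i)) C) S *
          setExp (fwt (fun i j => legendreMatrix p i j) (fun i => addLegendreSym 2 (p i))
            (fun i => addLegendreSym 2 (p i)) (fun i => addLegendreSym 2 (p i))) (univ \ S) := by
  rw [det_monskyMatrixEven_eq_det_bigN, det_bigN_eq_setExp, fwt_mark_eq_add, setExp_add]

end Split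

section GenusWeights

/-- The row-1 decomposition sum of a block product `≢ 1 (mod 8)` vanishes: every decomposition of it has a
factor `≢ 1 (mod 8)`. [cite: Smith2016CongruentDensity, §2 Definition of ℒ ("Otherwise, ℒ(n) = 0")] -/
theorem sum_decompositions_rowOne_eq_zero {T : Finset (Fin k)} (hT : (∏ i ∈ T, p i) % 8 ≠ 1) :
    ∑ D ∈ decompositions (∏ i ∈ T, p i), ∏ d ∈ D,
        (if d % 8 = 1 then ((genusClassNumber (GenusField d) : ℕ) : ZMod 2) else 0) = 0 := by
  refine sum_eq_zero fun D hD => ?_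
  obtain ⟨-, -, -, hprod⟩ := mem_decompositions_iff.mp hD
  have hex : ∃ d ∈ D, d % 8 ≠ 1 := by
    by_contra h
    push Not at h
    apply hT
    rw [← hprod, Finset.prod_nat_mod, prod_congr rfl fun d hd => h d hd, prod_const_one]
    rfl
  obtain ⟨d, hd, hd8⟩ := hex
  exact prod_eq_zero hd (if_neg hd8)

/-- For `∏ pᵢ ≡ 1 (mod 4)` and a block `S` whose complement has product `≡ 1 (mod 8)`, `Σ_S tᵢ = 0`
(`d_S ≡ 1 (mod 4)`). [cite: Smith2016CongruentDensity, §2.2 (chunk p0010 L4–L8: "d ≡ 1 (4)")] -/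
theorem sum_addLegendreSym_neg_one_block_eq_zero (hp : ∀ i, (p i).Prime) (hodd : ∀ i, Odd (p i))
    (h4 : (∏ i, p i) % 4 = 1) {S : Finset (Fin k)} (hS : (∏ i ∈ univ \ S, p i) % 8 = 1) :
    ∑ i ∈ S, addLegendreSym (-1) (p i) = 0 := by
  set q : Fin S.card → ℕ := fun x => p ((S.equivFin.symm x : {i // i ∈ S}) : Fin k) with hq
  have hqp : ∀ x, (q x).Prime := fun x => hp _
  have hqo : ∀ x, Odd (q x) := fun x => hodd _
  have hq2 : ∀ x, q x ≠ 2 := ne_two_of_odd q hqo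
  have hprod : ∏ x, q x = ∏ i ∈ S, p i := prod_subtuple p S
  have hsplit : (∏ i ∈ univ \ S, p i) * (∏ i ∈ S, p i) = ∏ i, p i := prod_sdiff (subset_univ S)
  have hS4 : (∏ i ∈ S, p i) % 4 = 1 := by
    have h : ((∏ i ∈ univ \ S, p i) * ∏ i ∈ S, p i) % 4 = (∏ i, p i) % 4 := by rw [hsplit]
    rw [Nat.mul_mod, show (∏ i ∈ univ \ S, p i) % 4 = 1 by omega, one_mul, Nat.mod_mod] at h
    rw [h, h4]
  rw [← sum_subtuple p S (fun n => addLegendreSym (-1) n), sum_addLegendreSym_neg_one_eq q hqp hq2, hprod,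
    if_pos hS4]

/-- **Each term of Smith's decomposition is `g(2 d_S) · ℒ(d_{Sᶜ})`**: for `∏ pᵢ ≡ 1 (mod 4)` and every `S`,
`det P(A, t, z)[S] · det M₁[Sᶜ] = g(2 d_S) · Σ_{D′ ∈ decompositions(d_{Sᶜ})} ∏ [d ≡ 1 (8)] g(d)` in `𝔽₂`
(both sides vanish unless `d_{Sᶜ} ≡ 1 (8)`, and then `d_S ≡ 1 (4)`).
[cite: Smith2016CongruentDensity, §2.2 (chunk p0010 L1–L8)] -/
theorem markWeight_mul_rowOne_eq (hp : ∀ i, (p i).Prime) (hodd : ∀ i, Odd (p i))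
    (hinj : Function.Injective p) (h4 : (∏ i, p i) % 4 = 1) (S : Finset (Fin k)) :
    setExp (fun C => (∑ i ∈ C, (addLegendreSym (-1) (p i) + addLegendreSym 2 (p i))) *
          qwt (fun i j => legendreMatrix p i j) (fun i => addLegendreSym 2 (p i)) C) S *
        setExp (fwt (fun i j => legendreMatrix p i j) (fun i => addLegendreSym 2 (p i))
          (fun i => addLegendreSym 2 (p i)) (fun i => addLegendreSym 2 (p i))) (univ \ S) =
      ((genusClassNumber (GenusField (2 * ∏ i ∈ S, p i)) : ℕ) : ZMod 2) *
        ∑ D ∈ decompositions (∏ i ∈ univ \ S, p i), ∏ d ∈ D,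
          (if d % 8 = 1 then ((genusClassNumber (GenusField d) : ℕ) : ZMod 2) else 0) := by
  rw [setExp_fwt_legendre_eq_sum_decompositions p hp hodd hinj (univ \ S)]
  by_cases hS : (∏ i ∈ univ \ S, p i) % 8 = 1
  · rw [setExp_markWeight_eq_genusWeight_two p hp hodd hinj S
      (sum_addLegendreSym_neg_one_block_eq_zero p hp hodd h4 hS)]
  · rw [sum_decompositions_rowOne_eq_zero p hS, mul_zero, mul_zero]

/-- **Monsky's even determinant as Smith's row-2 sum**: for `n = 2p₁⋯p_k` with `∏ pᵢ ≡ 1 (mod 4)`,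
`det M = Σ_{S ⊆ [k]} g(2 d_S) · Σ_{D′ ∈ decompositions(d_{Sᶜ})} ∏_{d ∈ D′} [d ≡ 1 (8)] g(d)` in `𝔽₂`
(`= Σ_{d | n even} g(d) ℒ(n/d)`). [cite: Smith2016CongruentDensity, Thm. 2.2 row 2 / Table 2 (ℒ₂(n) = Σ_{d | n, d ≡ n (16)} g(d) ℒ(n/d)) with §2.2 (chunk p0010 L1–L8)] -/
theorem det_monskyMatrixEven_eq_sum_genusWeight (hp : ∀ i, (p i).Prime) (hodd : ∀ i, Odd (p i))
    (hinj : Function.Injective p) (h4 : (∏ i, p i) % 4 = 1) :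
    (monskyMatrixEven p).det =
      ∑ S ∈ (univ : Finset (Fin k)).powerset,
        ((genusClassNumber (GenusField (2 * ∏ i ∈ S, p i)) : ℕ) : ZMod 2) *
          ∑ D ∈ decompositions (∏ i ∈ univ \ S, p i), ∏ d ∈ D,
            (if d % 8 = 1 then ((genusClassNumber (GenusField d) : ℕ) : ZMod 2) else 0) := by
  rw [det_monskyMatrixEven_eq_sum_powerset p]
  exact sum_congr rfl fun S _ => markWeight_mul_rowOne_eq p hp hodd hinj h4 S

end GenusWeights

end Literature.NumberTheory.EllipticCurves.Smith2016
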